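import Summits.KontsevichZagierPeriods.Zeta5Search.DenomLaw.OrbitCredit

/-!
# ζ(5) search — DENOM-LAW track D3 (denom-theory-d3 g4): the CLASS-ORBIT BOUND on the E-side — `ν⁺` is monotone under the contiguous shift, and the CASORATIAN ORBIT BOUND is a theorem

Second half of the seat file `HOME/denom-law/code/d3g4/lean/OrbitCredit.lean` v3 (sha256 b056c604…; author denom-theory-d3 g4, filed by the
prover seat denom-engine-d2 g4); see `DenomLaw/OrbitCredit.lean` for the statements, the HONEST FRAMING and the evidence ledger.
Content: `classNuPlus_shift_ge` (an unhit credited class keeps its credit under `b ↦ b + e_j` — `netExp_shift_eq_of_classExp_eq` — and a hit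
one gains at least one unit of exponent), **`casoratianOrbitBound_holds : CasoratianOrbitBound`**: `v_p(Cas_j(b)) ≥ LB⁺(b,p) = VB⁺ + rowMin`
for `1 ≤ j ≤ 7`, `b` and `b + e_j` in the polytope, `5 ≤ p ≤ b₀ < p² − 2`, `Cas_j(b) ≠ 0` — THEOREM LB (`casoratianClassBound_holds`) with
`padicNorm_coeffV_le_plus` for the two constant terms — and the propositional assembly `vh_shape`.  HONEST FRAMING: systematic search; a p-adic
valuation bound on the rational numbers `Cas_j(b)`; exactness rates quoted in the statements file are MODEL-side data; nothing about ζ(5);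
no irrationality claim; records in print UNMOVED.
-/

open Finset
open Summit.KontsevichZagierPeriods.Zeta5Search.WedgeDictionary (coeffV pfData dOf)
open Summit.KontsevichZagierPeriods.Zeta5Search.CasoratianValuation (InPolytope pairFloors shift casoratian)

namespace Summit.KontsevichZagierPeriods.Zeta5Search.ClusterValuation.Orbit

open Summit.KontsevichZagierPeriods.Zeta5Search.ClusterValuation
open Summit.KontsevichZagierPeriods.Zeta5Search.PadicSeries (one_le_p zpow_p_nonneg)
open Summit.KontsevichZagierPeriods.Zeta5Search.DualSeries (InBox)
open Summit.KontsevichZagierPeriods.Zeta5Search.BigPrime (shift_zero dOf_shift)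

/-! ### The E-side: `ν⁺` is monotone under the shift `b ↦ b + e_j`, hence THEOREM LB holds with `VB⁺` in place of `VB` -/

/-- Equal net exponents on a class give equal pole counts. -/
theorem classPoleCount_eq_of_netExp_eq {b b' : ℕ → ℤ} {p x : ℕ} (hcs : classSet b' p x = classSet b p x)
    (hnet : ∀ s ∈ classSet b p x, netExp b' s = netExp b s) : classPoleCount b' p x = classPoleCount b p x := by
  unfold classPoleCount
  rw [hcs, filter_congr (fun s hs => by rw [hnet s hs])]

/-- Equal net exponents on a class transport tameness. -/
theorem tameSingle_of_netExp_eq {b b' : ℕ → ℤ} {p x : ℕ} (hcs : classSet b' p x = classSet b p x)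
    (hnet : ∀ s ∈ classSet b p x, netExp b' s = netExp b s) (ht : tameSingle b' p x = true) : tameSingle b p x = true := by
  unfold tameSingle at ht ⊢
  rw [decide_eq_true_eq] at ht ⊢
  obtain ⟨q, hq, hqneg, hor⟩ := ht
  rw [hcs] at hq
  refine ⟨q, hq, by rw [← hnet q hq]; exact hqneg, ?_⟩
  rcases hor with h | h
  · exact Or.inl h
  · refine Or.inr fun s hs hsq => ?_
    have := h s (by rw [hcs]; exact hs) hsq
    rw [hnet s hs] at this
    exact this

/-- An unhit credited class stays credited under the shift. -/
theorem credited_shift_of_classExp_eq (b : ℕ → ℤ) {j : ℕ} (hb : InBox b) (hj1 : 1 ≤ j) {p x : ℕ} (hp : 0 < p) (hx : x < p)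
    (hE : classExp (shift b j) p x = classExp b p x) (hC : Credited b p x) : Credited (shift b j) p x := by
  have hcs : classSet (shift b j) p x = classSet b p x := classSet_shift b hj1 p x
  have hnet : ∀ s ∈ classSet b p x, netExp (shift b j) s = netExp b s := netExp_shift_eq_of_classExp_eq b hb hj1 hE
  obtain ⟨hnt, hcen, hpal, hev⟩ := hC
  refine ⟨?_, ?_, ?_, ?_⟩
  · rintro ⟨h1, ht⟩
    exact hnt ⟨by rw [← classPoleCount_eq_of_netExp_eq hcs hnet]; exact h1, tameSingle_of_netExp_eq hcs hnet ht⟩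
  · rw [centreIn_shift b hj1]; exact hcen
  · intro s hs
    rw [hcs] at hs
    rw [shift_zero b hj1, hnet s hs, hnet _ (palTau_class b hp hx hs).1]
    exact hpal s hs
  · rw [hE]; exact hev

/-- **`ν⁺_x(b + e_j) ≥ ν⁺_x(b)`** for every class keeping a pole: a credited class either keeps its net exponents (and its credit) or
gains at least one unit of exponent. -/
theorem classNuPlus_shift_ge (b : ℕ → ℤ) {j : ℕ} (hb : InBox b) (hj1 : 1 ≤ j) {p x : ℕ} (hp : 0 < p) (hx : x < p)
    (hpole' : 1 ≤ classPoleCount (shift b j) p x) : classNuPlus b p x ≤ classNuPlus (shift b j) p x := by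
  have hnu := classNu_shift_ge b hb hj1 hpole'
  have hE := classExp_shift_ge b hb hj1 p x
  unfold classNuPlus
  rw [orbitCredit_eq, orbitCredit_eq]
  by_cases hC : Credited b p x
  · rw [if_pos hC]
    by_cases hC' : Credited (shift b j) p x
    · rw [if_pos hC']; omega
    · rw [if_neg hC']
      have hn : classNu b p x = classExp b p x := by unfold classNu; rw [if_neg hC.1]
      have hn' : classExp (shift b j) p x ≤ classNu (shift b j) p x := by
        unfold classNu; split_ifs
        · exact le_max_left _ _
        · exact le_rfl
      by_cases heq : classExp (shift b j) p x = classExp b p x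
      · exact absurd (credited_shift_of_classExp_eq b hb hj1 hp hx heq hC) hC'
      · omega
  · rw [if_neg hC]; split_ifs <;> omega

/-- `VB⁺` is defined as soon as some class has a pole. -/
theorem vbPlus_isSome (b : ℕ → ℤ) {p x : ℕ} (hx : x < p) (hpole : 1 ≤ classPoleCount b p x) : ∃ v, vbPlus b p = some v := by
  have hmem : classNuPlus b p x ∈ ((List.range p).filter fun y => 1 ≤ classPoleCount b p y).map (classNuPlus b p) :=
    List.mem_map.2 ⟨x, List.mem_filter.2 ⟨List.mem_range.2 hx, by simpa using hpole⟩, rfl⟩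
  unfold vbPlus
  rcases h : (((List.range p).filter fun y => 1 ≤ classPoleCount b p y).map (classNuPlus b p)).min? with _ | v
  · rw [List.min?_eq_none_iff] at h
    rw [h] at hmem
    simp at hmem
  · exact ⟨v, rfl⟩

/-- **THE CASORATIAN ORBIT BOUND is a theorem**: `v_p(Cas_j(b)) ≥ LB⁺(b,p) = VB⁺ + rowMin` for `5 ≤ p ≤ b₀ < p² − 2`.  The proof is
THEOREM LB's (`casoratianClassBound_holds`) with `padicNorm_coeffV_le_plus` for the two constant terms and `classNuPlus_shift_ge`
for the shifted one. -/
theorem casoratianOrbitBound_holds : CasoratianOrbitBound := by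
  intro b j p hb hj1 hj7 hb' hprime hp5 hpb hwin hcas
  haveI : Fact p.Prime := ⟨hprime⟩
  have hp0 : 0 < p := hprime.pos
  have hp1 : (1 : ℚ) ≤ p := one_le_p
  have h0' : shift b j 0 = b 0 := shift_zero b hj1
  have hwin' : (shift b j 0 + 2 : ℤ) < (p : ℤ) ^ 2 := by rw [h0']; exact hwin
  have hpb' : (p : ℤ) ≤ shift b j 0 := by rw [h0']; exact hpb
  have hbox : InBox b := hb.1
  have hcnt : ∀ x, classPoleCount (shift b j) p x ≤ classPoleCount b p x :=
    fun x => classPoleCount_shift_le b hbox hj1 p x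
  -- Step 0: some class has a pole (otherwise `V(b) = V(b⁺) = 0` and `Cas_j = 0`)
  by_cases hnone : ∀ x, x < p → classPoleCount b p x = 0
  · exfalso
    apply hcas
    have hV0 : coeffV b = 0 := by
      rw [coeffV_eq_sum_classV b hprime.pos]
      exact sum_eq_zero fun x hx => classV_eq_zero_of_noPole b hb (hnone x (mem_range.1 hx))
    have hV0' : coeffV (shift b j) = 0 := by
      rw [coeffV_eq_sum_classV (shift b j) hprime.pos]
      refine sum_eq_zero fun x hx => classV_eq_zero_of_noPole _ hb' ?_
      have := hcnt x; have := hnone x (mem_range.1 hx); omega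
    unfold casoratian
    rw [hV0, hV0']; ring
  push Not at hnone
  obtain ⟨x₀, hx₀, hc₀⟩ := hnone
  have hpole₀ : 1 ≤ classPoleCount b p x₀ := by omega
  obtain ⟨v, hv⟩ := vbPlus_isSome b hx₀ hpole₀
  obtain ⟨r, hr⟩ := rowMin_isSome b hx₀ hpole₀
  have hLB : casLBPlus b p = v + r := by simp [casLBPlus, hv, hr]
  rw [hLB]
  -- Step (i)+(ii): the constant terms, now with `ν⁺`
  have hvle : ∀ y, y < p → 1 ≤ classPoleCount b p y → v ≤ classNuPlus b p y :=
    fun y hy hpole => le_classNuPlus_of_vbPlus b hv hy hpole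
  have hVb : padicNorm p (coeffV b) ≤ (p : ℚ) ^ (-v) := padicNorm_coeffV_le_plus b hb hp5 hpb hwin v hvle
  have hVb' : padicNorm p (coeffV (shift b j)) ≤ (p : ℚ) ^ (-v) :=
    padicNorm_coeffV_le_plus (shift b j) hb' hp5 hpb' hwin' v fun y hy hpole' =>
      (hvle y hy (le_trans hpole' (hcnt y))).trans (classNuPlus_shift_ge b hbox hj1 hp0 hy hpole')
  -- Step (iii)+(iv): the rows (verbatim from THEOREM LB)
  have hrow : ∀ x ∈ range p,
      padicNorm p (classK (shift b j) p x * coeffV b - classK b p x * coeffV (shift b j)) ≤ (p : ℚ) ^ (-(v + r)) := by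
    intro x hx
    have hx' := mem_range.1 hx
    rcases Nat.lt_trichotomy (classPoleCount b p x) 1 with hc | hc | hc
    · have h0 : classPoleCount b p x = 0 := by omega
      have h0s : classPoleCount (shift b j) p x = 0 := by have := hcnt x; omega
      rw [classK_eq_zero_of_noPole b hb h0, classK_eq_zero_of_noPole _ hb' h0s, zero_mul, zero_mul, sub_zero,
        padicNorm.zero]
      exact zpow_p_nonneg _
    · have hr1 : r ≤ 1 := rowMin_le_one b hr hx' hc
      have hK : padicNorm p (classK b p x) ≤ (p : ℚ) ^ (-(1 : ℤ)) := padicNorm_classK_le_single b hb hp5 hwin hx' hc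
      have hK' : padicNorm p (classK (shift b j) p x) ≤ (p : ℚ) ^ (-(1 : ℤ)) := by
        rcases Nat.eq_zero_or_pos (classPoleCount (shift b j) p x) with h0s | hpos
        · rw [classK_eq_zero_of_noPole _ hb' h0s, padicNorm.zero]; exact zpow_p_nonneg _
        · exact padicNorm_classK_le_single _ hb' hp5 hwin' hx' (by have := hcnt x; omega)
      refine (padicNorm.sub (p := p)).trans (max_le ?_ ?_)
      · exact (padicNorm_mul_le hK' hVb).trans (zpow_le_zpow_right₀ hp1 (by linarith))
      · exact (padicNorm_mul_le hK hVb').trans (zpow_le_zpow_right₀ hp1 (by linarith))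
    · have hr3 : r ≤ 3 + classExp b p x := rowMin_le_multi b hr hx' (by omega)
      have hK : padicNorm p (classK b p x) ≤ (p : ℚ) ^ (-(3 + classExp b p x)) :=
        padicNorm_classK_le_multi b hb hp5 hwin hx' (by omega)
      have hK' : padicNorm p (classK (shift b j) p x) ≤ (p : ℚ) ^ (-(3 + classExp b p x)) := by
        rcases Nat.eq_zero_or_pos (classPoleCount (shift b j) p x) with h0s | hpos
        · rw [classK_eq_zero_of_noPole _ hb' h0s, padicNorm.zero]; exact zpow_p_nonneg _
        · exact (padicNorm_classK_le_multi _ hb' hp5 hwin' hx' hpos).trans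
            (zpow_le_zpow_right₀ hp1 (by linarith [classExp_shift_ge b hbox hj1 p x]))
      refine (padicNorm.sub (p := p)).trans (max_le ?_ ?_)
      · exact (padicNorm_mul_le hK' hVb).trans (zpow_le_zpow_right₀ hp1 (by linarith))
      · exact (padicNorm_mul_le hK hVb').trans (zpow_le_zpow_right₀ hp1 (by linarith))
  have hB : padicNorm p (kRes (shift b j) p * coeffV b - kRes b p * coeffV (shift b j)) ≤ (p : ℚ) ^ (-(v + r)) := by
    rw [kRes_eq_sum_classK (shift b j) hprime.pos, kRes_eq_sum_classK b hprime.pos, sum_mul, sum_mul,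
      ← sum_sub_distrib]
    exact padicNorm.sum_le' hrow (zpow_p_nonneg _)
  -- Step (v)+(vi): the Ω-bracket and the assembly
  apply val_ge_of_padicNorm_le hcas
  rw [casoratian_split b j p]
  have hdshift : dOf (shift b j) = dOf b - 1 := dOf_shift b hj1 hj7
  by_cases hpd : (p : ℤ) ≤ dOf b
  · rw [omegaRes_eq_zero b hb (by omega), omegaRes_eq_zero (shift b j) hb' (by rw [hdshift]; omega), zero_mul,
      zero_mul, sub_zero, zero_sub, padicNorm.neg]
    exact hB
  · have hr0 : r ≤ 0 := rowMin_le_zero b hr (by push Not at hpd; exact_mod_cast hpd)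
    refine (padicNorm.sub (p := p)).trans (max_le ?_ hB)
    refine (padicNorm.sub (p := p)).trans (max_le ?_ ?_)
    · have h1 : padicNorm p (omegaRes (shift b j) p) ≤ (p : ℚ) ^ (0 : ℤ) := by
        simpa using padicNorm_omegaRes_le_one (shift b j) hb' (by omega)
      exact (padicNorm_mul_le h1 hVb).trans (zpow_le_zpow_right₀ hp1 (by linarith))
    · have h1 : padicNorm p (omegaRes b p) ≤ (p : ℚ) ^ (0 : ℤ) := by
        simpa using padicNorm_omegaRes_le_one b hb (by omega)
      exact (padicNorm_mul_le h1 hVb').trans (zpow_le_zpow_right₀ hp1 (by linarith))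

/-- Sanity: the assembly `ClassOrbitBound ∧ OrbitFloorHStar ⇒ (VH)` is propositional bookkeeping (stated, not the point of this file). -/
theorem vh_shape (hC : ClassOrbitBound) (hF : OrbitFloorHStar) :
    ∀ (b : ℕ → ℤ) (p : ℕ) (v : ℤ), InPolytope b → p.Prime → 5 ≤ p → (p : ℤ) ≤ b 0 → (b 0 + 2 : ℤ) < (p : ℤ) ^ 2 →
      (p : ℤ) ≤ dOf b → dOf b < 2 * (p : ℤ) → mOne b < 2 * (p : ℤ) → LoopAndPair b p →
        vbPlus b p = some v → coeffV b ≠ 0 → ((-pairFloors b p + 1 : ℤ) : ℚ) ≤ (padicValRat p (coeffV b) : ℚ) := by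
  intro b p v hP hp h5 hpb hw hd1 hd2 hm hH hv hV
  have a := hF b p v hP hp h5 hpb hw hd1 hd2 hm hH hv
  have c := hC b p v hP hp h5 hpb hw hv hV
  exact_mod_cast a.trans c

end Summit.KontsevichZagierPeriods.Zeta5Search.ClusterValuation.Orbit
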